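import Mathlib
import Summits.NavierStokesRegularity.NavierStokesRegularity.Theorems.LandauTailLandauTailBlowupMomentumLaw
import Summits.NavierStokesRegularity.NavierStokesRegularity.Theorems.LandauTailLandauTailBlowupPlateauTest

/-!
# Crux `LandauTail.LandauTailBlowup` (stmt-NavierStokesRegularity-1944), line `registered`, cycle c7:
  stub `landauTail_shell_energy_floor` — the SHELL THEOREM, energy form

Helper file on the proof path of the crux item `stmt-NavierStokesRegularity-1944`
(`Summit.NavierStokesRegularity.NavierStokesRegularity.Theses.LandauTail.LandauTailBlowup`), lead c7: the
registered support stub `landauTail_shell_energy_floor` (L2), composed from the exact local momentum law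
(`landauTail_momentum_law`, p173098) and the plateau test (`landauTail_exists_plateau_test`, p173017).

THEOREM. For a nonzero steady `(−1)`-homogeneous profile `(U, P)` smooth off the origin (a Landau solution) there
are `c, ε > 0` such that every classical unit-viscosity flow `v` on `ℝ³ × (−1,0)` which is `L²`-CLOSE TO THE
LANDAU FLOW ON A SHELL, `∫_{s₁}^{s₂}∫_{ρ/2<|y|<ρ} |v − U|² ≤ ε ρ (s₂ − s₁)` (a fixed fraction of Landau's own
`L²`-mass there), has, at `t = s₁` or `t = s₂`, kinetic energy `∫_{B_ρ}|v(t)|² ≥ c (s₂ − s₁)² ρ⁻³` INSIDE the shell.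

PROOF ("energy ≥ momentum²/volume"). With the plateau test `φ_ρ` (`= a` on `B̄_{ρ/2}`, `|φ_ρ| ≤ K`) the momentum
law gives `M′ = −β + E`, and the shell closeness makes `∫_{s₁}^{s₂}|E| ≤ β(s₂−s₁)/2` (Young's inequality on the
shell turns the `L²`-smallness into the `L¹`-smallness the linear error terms need); hence
`M(s₁) − M(s₂) ≥ β(s₂−s₁)/2`, so `|M(t)| ≥ β(s₂−s₁)/4` at an endpoint, while
`|M(t)| ≤ ‖φ_ρ‖_{L²}‖v(t)‖_{L²(B_ρ)} ≤ K |B_ρ|^{1/2} ‖v(t)‖_{L²(B_ρ)}`.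

References: L. D. Landau 1944; G. K. Batchelor 1967 §4.6; P. G. Lemarié-Rieusset 2016 (10.48); STRATEGY-CENSUS §F3
of the crux (kinetic energy ≥ |momentum|²/(2|B_ℓ|)).
-/

set_option linter.dupNamespace false

noncomputable section

open Filter Set Topology MeasureTheory Metric Function
open scoped ENNReal NNReal InnerProductSpace RealInnerProductSpace Laplacian ContDiff
open Literature.Analysis.FluidPDE

namespace Summit.NavierStokesRegularity.NavierStokesRegularity.Theorems

/-! ### Elementary inequalities -/

/-- Young: `‖w‖ ≤ ‖w‖²/(2γ) + γ/2` for `γ > 0`. [folklore] -/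
theorem landauTail_shellFloor_norm_le {F : Type*} [NormedAddCommGroup F] (w : F) {γ : ℝ} (hγ : 0 < γ) :
    ‖w‖ ≤ ‖w‖ ^ 2 / (2 * γ) + γ / 2 := by
  have h := two_mul_le_add_sq ‖w‖ γ
  rw [div_add_div _ _ (by positivity) two_ne_zero, le_div_iff₀ (by positivity)]
  nlinarith [norm_nonneg w]

/-- Young for the pairing: `|⟪v, φ⟫| ≤ ‖v‖²/(2θ) + θK²/2` when `‖φ‖ ≤ K`, `θ > 0`. [folklore] -/
theorem landauTail_shellFloor_abs_inner_le (v φ : EuclideanSpace ℝ (Fin 3)) {θ K : ℝ} (hθ : 0 < θ)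
    (hφ : ‖φ‖ ≤ K) : |⟪v, φ⟫| ≤ ‖v‖ ^ 2 / (2 * θ) + θ * K ^ 2 / 2 := by
  have hK : 0 ≤ K := (norm_nonneg _).trans hφ
  have h1 : |⟪v, φ⟫| ≤ ‖v‖ * K :=
    (abs_real_inner_le_norm v φ).trans (mul_le_mul_of_nonneg_left hφ (norm_nonneg _))
  have h2 := two_mul_le_add_sq ‖v‖ (θ * K)
  rw [div_add_div _ _ (by positivity) two_ne_zero, le_div_iff₀ (by positivity)]
  nlinarith [norm_nonneg v, mul_nonneg hθ.le hK]

/-- Young in `ℝ≥0∞`: `‖w‖ₑ ≤ (2γ)⁻¹ ‖w‖ₑ² + γ/2`. [folklore] -/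
theorem landauTail_shellFloor_enorm_le {F : Type*} [NormedAddCommGroup F] (w : F) {γ : ℝ} (hγ : 0 < γ) :
    ‖w‖ₑ ≤ ENNReal.ofReal (1 / (2 * γ)) * ‖w‖ₑ ^ 2 + ENNReal.ofReal (γ / 2) := by
  have h := landauTail_shellFloor_norm_le w hγ
  calc ‖w‖ₑ = ENNReal.ofReal ‖w‖ := (ofReal_norm w).symm
    _ ≤ ENNReal.ofReal (1 / (2 * γ) * ‖w‖ ^ 2 + γ / 2) :=
        ENNReal.ofReal_le_ofReal (by rw [one_div_mul_eq_div]; exact h)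
    _ = ENNReal.ofReal (1 / (2 * γ)) * ‖w‖ₑ ^ 2 + ENNReal.ofReal (γ / 2) := by
        rw [ENNReal.ofReal_add (by positivity) (by positivity), ENNReal.ofReal_mul (by positivity),
          ← ofReal_norm, ← ENNReal.ofReal_pow (norm_nonneg _)]

/-- Transfer of a two-term real bound to `ℝ≥0∞`. [folklore] -/
theorem landauTail_shellFloor_ofReal_le {x a b A B : ℝ} {Ga Gb : ℝ≥0∞} (hA : 0 ≤ A) (hB : 0 ≤ B)
    (ha : 0 ≤ a) (hb : 0 ≤ b) (hx : x ≤ A * a + B * b) (hGa : ENNReal.ofReal a ≤ Ga)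
    (hGb : ENNReal.ofReal b ≤ Gb) :
    ENNReal.ofReal x ≤ ENNReal.ofReal A * Ga + ENNReal.ofReal B * Gb := by
  calc ENNReal.ofReal x ≤ ENNReal.ofReal (A * a + B * b) := ENNReal.ofReal_le_ofReal hx
    _ = ENNReal.ofReal A * ENNReal.ofReal a + ENNReal.ofReal B * ENNReal.ofReal b := by
        rw [ENNReal.ofReal_add (mul_nonneg hA ha) (mul_nonneg hB hb), ENNReal.ofReal_mul hA,
          ENNReal.ofReal_mul hB]
    _ ≤ ENNReal.ofReal A * Ga + ENNReal.ofReal B * Gb := by gcongr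

/-! ### Calculus: the momentum drop over a window -/

/-- If `M′ = F` on `[s₁, s₂]` with `F` continuous and `∫_{s₁}^{s₂} |F + β| ≤ B`, then
`M(s₁) − M(s₂) ≥ β (s₂ − s₁) − B`. [folklore] -/
theorem landauTail_shellFloor_drop {M F : ℝ → ℝ} {β B s₁ s₂ : ℝ} (hs : s₁ < s₂)
    (hder : ∀ t ∈ Icc s₁ s₂, HasDerivAt M (F t) t) (hcont : ContinuousOn F (Icc s₁ s₂))
    (hint : ∫ t in Ioo s₁ s₂, |F t + β| ≤ B) : β * (s₂ - s₁) - B ≤ M s₁ - M s₂ := by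
  have hFint : IntervalIntegrable F volume s₁ s₂ := (hcont.mono (by rw [uIcc_of_le hs.le])).intervalIntegrable
  have hFTC : ∫ t in s₁..s₂, F t = M s₂ - M s₁ :=
    intervalIntegral.integral_eq_sub_of_hasDerivAt (fun t ht => hder t (by rwa [uIcc_of_le hs.le] at ht)) hFint
  have h1 : ∫ t in s₁..s₂, (F t + β) = (M s₂ - M s₁) + β * (s₂ - s₁) := by
    rw [intervalIntegral.integral_add hFint (by simp), hFTC, intervalIntegral.integral_const, smul_eq_mul]
    ring
  have h2 : ∫ t in s₁..s₂, (F t + β) ≤ ∫ t in s₁..s₂, |F t + β| :=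
    (le_abs_self _).trans (intervalIntegral.abs_integral_le_integral_abs hs.le)
  have h3 : ∫ t in s₁..s₂, |F t + β| = ∫ t in Ioo s₁ s₂, |F t + β| := by
    rw [intervalIntegral.integral_of_le hs.le, integral_Ioc_eq_integral_Ioo]
  linarith [h1, h2, h3, hint]

/-! ### Energy from momentum on a ball -/

/-- The volume of the ball `B_ρ ⊆ ℝ³` is `ρ³ |B₁|`. [folklore] -/
theorem landauTail_shellFloor_volume_ball {ρ : ℝ} (hρ : 0 < ρ) :
    volume (ball (0 : EuclideanSpace ℝ (Fin 3)) ρ) =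
      ENNReal.ofReal (ρ ^ 3) * volume (ball (0 : EuclideanSpace ℝ (Fin 3)) 1) := by
  rw [Measure.addHaar_ball_of_pos volume 0 hρ, finrank_euclideanSpace_fin]

/-- **Energy ≥ momentum²/volume.** For a continuous field `V` and a field `φ` with `|φ| ≤ K` supported in `B_ρ`,
`|∫⟪V, φ⟫|² ≤ K² |B_ρ| ∫_{B_ρ} |V|²` — in the form `m ≤ |∫⟪V,φ⟫| ⇒ m²/(K²ρ³|B₁|) ≤ ∫_{B_ρ}|V|²`. [folklore] -/
theorem landauTail_shellFloor_energy_of_momentum {V φ : EuclideanSpace ℝ (Fin 3) → EuclideanSpace ℝ (Fin 3)}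
    {K ρ m : ℝ} (hV : Continuous V) (hφK : ∀ x, ‖φ x‖ ≤ K)
    (hφsupp : tsupport φ ⊆ ball (0 : EuclideanSpace ℝ (Fin 3)) ρ) (hK : 0 < K) (hρ : 0 < ρ) (hm : 0 < m)
    (hmM : m ≤ |∫ x, ⟪V x, φ x⟫|) :
    m ^ 2 / (K ^ 2 * (ρ ^ 3 * (volume (ball (0 : EuclideanSpace ℝ (Fin 3)) 1)).toReal)) ≤
      ∫ x in ball (0 : EuclideanSpace ℝ (Fin 3)) ρ, ‖V x‖ ^ 2 := by
  set V₁ : ℝ := (volume (ball (0 : EuclideanSpace ℝ (Fin 3)) 1)).toReal with hV₁_def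
  have hV₁top : volume (ball (0 : EuclideanSpace ℝ (Fin 3)) 1) ≠ ⊤ := measure_ball_lt_top.ne
  have hV₁pos : 0 < V₁ := ENNReal.toReal_pos (measure_ball_pos volume 0 one_pos).ne' hV₁top
  set Eρ : ℝ := ∫ x in ball (0 : EuclideanSpace ℝ (Fin 3)) ρ, ‖V x‖ ^ 2 with hEρ_def
  have hEint : IntegrableOn (fun x => ‖V x‖ ^ 2) (ball (0 : EuclideanSpace ℝ (Fin 3)) ρ) volume :=
    ((hV.norm.pow 2).continuousOn.integrableOn_compact (isCompact_closedBall 0 ρ)).mono_set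
      ball_subset_closedBall
  have hMball : ∫ x, ⟪V x, φ x⟫ = ∫ x in ball (0 : EuclideanSpace ℝ (Fin 3)) ρ, ⟪V x, φ x⟫ := by
    refine (setIntegral_eq_integral_of_forall_compl_eq_zero fun x hx => ?_).symm
    have hx' : x ∉ tsupport φ := fun h => hx (hφsupp h)
    rw [image_eq_zero_of_notMem_tsupport hx', inner_zero_right]
  have hvolB : (volume (ball (0 : EuclideanSpace ℝ (Fin 3)) ρ)).toReal = ρ ^ 3 * V₁ := by
    rw [landauTail_shellFloor_volume_ball hρ, ENNReal.toReal_mul, ENNReal.toReal_ofReal (by positivity),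
      hV₁_def]
  have hMle : ∀ θ : ℝ, 0 < θ → |∫ x, ⟪V x, φ x⟫| ≤ Eρ / (2 * θ) + θ * K ^ 2 / 2 * (ρ ^ 3 * V₁) := by
    intro θ hθ
    calc |∫ x, ⟪V x, φ x⟫| = |∫ x in ball (0 : EuclideanSpace ℝ (Fin 3)) ρ, ⟪V x, φ x⟫| := by rw [hMball]
      _ ≤ ∫ x in ball (0 : EuclideanSpace ℝ (Fin 3)) ρ, |⟪V x, φ x⟫| := abs_integral_le_integral_abs
      _ ≤ ∫ x in ball (0 : EuclideanSpace ℝ (Fin 3)) ρ, (‖V x‖ ^ 2 / (2 * θ) + θ * K ^ 2 / 2) := by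
          refine integral_mono_of_nonneg (Eventually.of_forall fun x => abs_nonneg _) ?_
            (Eventually.of_forall fun x => landauTail_shellFloor_abs_inner_le _ _ hθ (hφK x))
          exact (hEint.div_const _).add (integrableOn_const measure_ball_lt_top.ne)
      _ = Eρ / (2 * θ) + θ * K ^ 2 / 2 * (ρ ^ 3 * V₁) := by
          rw [integral_add (hEint.div_const _) (integrableOn_const measure_ball_lt_top.ne),
            integral_div, setIntegral_const, smul_eq_mul, measureReal_def, hvolB, hEρ_def]
          ring
  have hMpos : 0 < |∫ x, ⟪V x, φ x⟫| := hm.trans_le hmM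
  have hD : 0 < K ^ 2 * (ρ ^ 3 * V₁) := by positivity
  set μ₀ : ℝ := |∫ x, ⟪V x, φ x⟫| with hμ₀
  have hElow : μ₀ ^ 2 / (K ^ 2 * (ρ ^ 3 * V₁)) ≤ Eρ := by
    have h := hMle (μ₀ / (K ^ 2 * (ρ ^ 3 * V₁))) (by positivity)
    have e : μ₀ / (K ^ 2 * (ρ ^ 3 * V₁)) * K ^ 2 / 2 * (ρ ^ 3 * V₁) = μ₀ / 2 := by
      field_simp
    rw [e] at h
    have h' : μ₀ / 2 ≤ Eρ / (2 * (μ₀ / (K ^ 2 * (ρ ^ 3 * V₁)))) := by linarith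
    rw [div_le_div_iff₀ two_pos (by positivity)] at h'
    rw [div_le_iff₀ hD]
    -- `h' : μ₀ * (2 * (μ₀ / D)) ≤ Eρ * 2`
    have e2 : μ₀ * (2 * (μ₀ / (K ^ 2 * (ρ ^ 3 * V₁)))) = 2 * (μ₀ ^ 2 / (K ^ 2 * (ρ ^ 3 * V₁))) := by ring
    rw [e2] at h'
    have h'' : μ₀ ^ 2 / (K ^ 2 * (ρ ^ 3 * V₁)) ≤ Eρ := by linarith
    rwa [div_le_iff₀ hD] at h''
  refine le_trans ?_ hElow
  rw [div_le_div_iff₀ hD hD]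
  have hsq : m ^ 2 ≤ μ₀ ^ 2 := pow_le_pow_left₀ hm.le hmM 2
  nlinarith [hsq, hD]

/-! ### The shell theorem -/

/-- A real-valued function continuous on a compact `T` is integrable on every measurable `S ⊆ T`, and its set
integral is the `toReal` of the corresponding lower integral when it is nonnegative. [folklore] -/
theorem landauTail_shellFloor_integral_eq_toReal {g : EuclideanSpace ℝ (Fin 3) → ℝ}
    {S T : Set (EuclideanSpace ℝ (Fin 3))} (hT : IsCompact T) (hST : S ⊆ T) (hS : MeasurableSet S)
    (hg : ContinuousOn g T) (h0 : ∀ x ∈ S, 0 ≤ g x) :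
    ∫ x in S, g x = (∫⁻ x in S, ENNReal.ofReal (g x)).toReal := by
  have hint : IntegrableOn g S volume := (hg.integrableOn_compact hT).mono_set hST
  exact integral_eq_lintegral_of_nonneg_ae ((ae_restrict_iff' hS).2 (Eventually.of_forall h0))
    hint.aestronglyMeasurable


set_option maxHeartbeats 400000 in
/-- **L2 — SHELL THEOREM, energy form** (registered support stub of crux stmt-NavierStokesRegularity-1944, lead c7;
Landau 1944, Batchelor 1967 §4.6, Lemarié-Rieusset 2016 (10.48)): there are `c, ε > 0` depending only on the
profile such that every classical unit-viscosity flow `v` on `ℝ³ × (−1,0)` which is `L²`-close to the Landau flow on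
a shell, `∫_{s₁}^{s₂}∫_{ρ/2<|y|<ρ} |v − U|² ≤ ε ρ (s₂ − s₁)`, carries at some time of the window kinetic energy
`∫_{B_ρ}|v(t)|² ≥ c (s₂ − s₁)² ρ⁻³` inside the shell (the momentum `≈ β(s₂ − s₁)` fed to the jet must sit inside, and
energy `≥ momentum²/volume`). [folklore] -/
theorem landauTail_shell_energy_floor : ∀ (U : EuclideanSpace ℝ (Fin 3) → EuclideanSpace ℝ (Fin 3)) (P : EuclideanSpace ℝ (Fin 3) → ℝ), (ContDiffOn ℝ (⊤ : ℕ∞) U {0}ᶜ ∧ ContDiffOn ℝ (⊤ : ℕ∞) P {0}ᶜ ∧ (∀ x : EuclideanSpace ℝ (Fin 3), x ≠ 0 → Literature.Analysis.FluidPDE.convect U U x + gradient P x = (1 : ℝ) • Laplacian.laplacian U x) ∧ (∀ x : EuclideanSpace ℝ (Fin 3), x ≠ 0 → Literature.Analysis.FluidPDE.VectorCalculus.divergence U x = 0) ∧ (∀ c : ℝ, 0 < c → ∀ x : EuclideanSpace ℝ (Fin 3), U (c • x) = c⁻¹ • U x) ∧ (∃ x : EuclideanSpace ℝ (Fin 3),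 U x ≠ 0)) → ∃ c : ℝ, 0 < c ∧ ∃ ε : ℝ, 0 < ε ∧ ∀ (v : ℝ → EuclideanSpace ℝ (Fin 3) → EuclideanSpace ℝ (Fin 3)) (q : ℝ → EuclideanSpace ℝ (Fin 3) → ℝ), Literature.Analysis.FluidPDE.IsClassicalNSSolutionOn (Set.Ioo (-1) 0) 1 0 v q → ∀ ρ : ℝ, 0 < ρ → ρ ≤ 1 → ∀ s₁ s₂ : ℝ, -1 < s₁ → s₁ < s₂ → s₂ < 0 → (∫⁻ z in Set.Ioo s₁ s₂ ×ˢ (Metric.ball (0 : EuclideanSpace ℝ (Fin 3)) ρ \ Metric.closedBall (0 : EuclideanSpace ℝ (Fin 3)) (ρ / 2)), ‖v z.1 z.2 - U z.2‖ₑ ^ 2) ≤ ENNReal.ofReal (ε * ρ * (s₂ - s₁)) → ∃ t ∈ Set.Icc s₁ s₂, ENNReal.ofReal (c * (s₂ - s₁) ^ 2 / ρ ^ 3) ≤ ∫⁻ x in Metric.ball (0 : EuclideanSpace ℝ (Fin 3)) ρ, ‖v t x‖ₑ ^ 2 := by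
  intro U P hprof
  have hUc : ContinuousOn U {0}ᶜ := hprof.1.continuousOn
  obtain ⟨a, ha, β, hβ, L, hL, hlaw⟩ := landauTail_momentum_law U P hprof
  obtain ⟨K, hK0, hφfam⟩ := landauTail_exists_plateau_test a
  -- `K ≥ 1` since `φ(0) = a` is a unit vector
  have hK1 : 1 ≤ K := by
    obtain ⟨φ, Ψ, -, -, -, -, hφa, -, -, hφK, -⟩ := hφfam 1 one_pos
    have h := hφK 0
    rwa [hφa 0 (mem_closedBall_self (by norm_num)), ha] at h
  have hKpos : 0 < K := one_pos.trans_le hK1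
  -- the unit-ball volume
  set V₁ : ℝ := (volume (ball (0 : EuclideanSpace ℝ (Fin 3)) 1)).toReal with hV₁_def
  have hV₁top : volume (ball (0 : EuclideanSpace ℝ (Fin 3)) 1) ≠ ⊤ := measure_ball_lt_top.ne
  have hV₁pos : 0 < V₁ := ENNReal.toReal_pos (measure_ball_pos volume 0 one_pos).ne' hV₁top
  -- the constants
  set κ : ℝ := K * (1 + 4 * L) * (1 + V₁) / 2 + K with hκ_def
  have hκ : 0 ≤ κ := by positivity
  set η : ℝ := min 1 (β / (2 * (κ + 1))) with hη_def
  have hη0 : 0 < η := lt_min one_pos (by positivity)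
  have hη1 : η ≤ 1 := min_le_left _ _
  have hηβ : η ≤ β / (2 * (κ + 1)) := min_le_right _ _
  set c : ℝ := (β / 4) ^ 2 / (K ^ 2 * V₁) with hc_def
  refine ⟨c, by positivity, η ^ 2, by positivity, ?_⟩
  intro v q hcl ρ hρ _hρ1 s₁ s₂ hs₁ hs₁₂ hs₂ hclose
  set Δs : ℝ := s₂ - s₁ with hΔs_def
  have hΔs : 0 < Δs := by rw [hΔs_def]; linarith
  obtain ⟨φ, Ψ, hφs, -, hφsupp, hφdiv, hφa, hφD0, hφΔ0, hφK, hφD, hφΔ, -, -, -, -, -⟩ := hφfam ρ hρ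
  obtain ⟨hder, hcont, herr⟩ := hlaw v q hcl ρ K φ hρ hK0 hφs hφsupp hφdiv hφa hφD0 hφΔ0 hφD hφΔ
  -- names
  set M : ℝ → ℝ := fun s => ∫ x, ⟪v s x, φ x⟫ with hM_def
  set Fl : ℝ → ℝ := fun t => ∫ x, (⟪v t x, convect (v t) φ x⟫ + ⟪v t x, Δ φ x⟫) with hFl_def
  set S : Set (EuclideanSpace ℝ (Fin 3)) := ball (0 : EuclideanSpace ℝ (Fin 3)) ρ \
    closedBall (0 : EuclideanSpace ℝ (Fin 3)) (ρ / 2) with hS_def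
  set T : Set (EuclideanSpace ℝ (Fin 3)) := closedBall (0 : EuclideanSpace ℝ (Fin 3)) ρ \
    ball (0 : EuclideanSpace ℝ (Fin 3)) (ρ / 2) with hT_def
  set I : Set ℝ := Ioo s₁ s₂ with hI_def
  have hST : S ⊆ T := sdiff_subset_sdiff ball_subset_closedBall ball_subset_closedBall
  have hTc : IsCompact T := (isCompact_closedBall _ _).diff isOpen_ball
  have hSm : MeasurableSet S := measurableSet_ball.diff measurableSet_closedBall
  have hT0 : T ⊆ {0}ᶜ := by
    intro x hx h0
    rw [mem_singleton_iff] at h0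
    exact hx.2 (by rw [h0]; exact mem_ball_self (by positivity))
  have hIsub : I ⊆ Ioo (-1 : ℝ) 0 := fun t ht => ⟨hs₁.trans ht.1, ht.2.trans hs₂⟩
  have hIcc : Icc s₁ s₂ ⊆ Ioo (-1 : ℝ) 0 := fun t ht => ⟨hs₁.trans_le ht.1, ht.2.trans_lt hs₂⟩
  -- continuity of `(t, x) ↦ v t x - U x` on `Ioo (-1) 0 ×ˢ T`
  have hvc : ContinuousOn (uncurry v) (Ioo (-1 : ℝ) 0 ×ˢ univ) := hcl.smooth_velocity.continuousOn
  have hwc : ContinuousOn (fun z : ℝ × EuclideanSpace ℝ (Fin 3) => v z.1 z.2 - U z.2)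
      (Ioo (-1 : ℝ) 0 ×ˢ T) :=
    (hvc.mono (prod_mono Subset.rfl (subset_univ _))).sub
      (hUc.comp continuous_snd.continuousOn fun z hz => hT0 hz.2)
  have hslice : ∀ t ∈ Ioo (-1 : ℝ) 0, ContinuousOn (fun x => v t x - U x) T := fun t ht =>
    (hcl.contDiff_velocity ht).continuous.continuousOn.sub (hUc.mono hT0)
  -- the per-time lower integrals and the conversion of the real shell integrals
  set G1 : ℝ → ℝ≥0∞ := fun t => ∫⁻ x in S, ‖v t x - U x‖ₑ with hG1_def
  set G2 : ℝ → ℝ≥0∞ := fun t => ∫⁻ x in S, ‖v t x - U x‖ₑ ^ 2 with hG2_def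
  have hg1 : ∀ t ∈ Ioo (-1 : ℝ) 0, ENNReal.ofReal (∫ x in S, ‖v t x - U x‖) ≤ G1 t := by
    intro t ht
    rw [landauTail_shellFloor_integral_eq_toReal (g := fun x => ‖v t x - U x‖) hTc hST hSm (hslice t ht).norm
      (fun x _ => norm_nonneg _)]
    refine ENNReal.ofReal_toReal_le.trans (le_of_eq (lintegral_congr fun x => ofReal_norm _))
  have hg2 : ∀ t ∈ Ioo (-1 : ℝ) 0, ENNReal.ofReal (∫ x in S, ‖v t x - U x‖ ^ 2) ≤ G2 t := by
    intro t ht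
    rw [landauTail_shellFloor_integral_eq_toReal (g := fun x => ‖v t x - U x‖ ^ 2) hTc hST hSm
      ((hslice t ht).norm.pow 2) (fun x _ => by positivity)]
    refine ENNReal.ofReal_toReal_le.trans (le_of_eq (lintegral_congr fun x => ?_))
    rw [← ofReal_norm, ENNReal.ofReal_pow (norm_nonneg _)]
  -- pointwise-in-time error bound in `ℝ≥0∞`
  set A₁ : ℝ := K / ρ ^ 2 * (1 + 4 * L) with hA₁_def
  set A₂ : ℝ := K / ρ with hA₂_def
  have hA₁ : 0 ≤ A₁ := by positivity
  have hA₂ : 0 ≤ A₂ := by positivity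
  have hP : ∀ t ∈ I, ENNReal.ofReal |Fl t + β| ≤ ENNReal.ofReal A₁ * G1 t + ENNReal.ofReal A₂ * G2 t := by
    intro t ht
    have ht' := hIsub ht
    exact landauTail_shellFloor_ofReal_le hA₁ hA₂ (integral_nonneg fun x => norm_nonneg _)
      (integral_nonneg fun x => by positivity) (herr t ht') (hg1 t ht') (hg2 t ht')
  -- measurability on the space-time shell `I ×ˢ S`
  have hQsub : I ×ˢ S ⊆ Ioo (-1 : ℝ) 0 ×ˢ T := prod_mono hIsub hST
  have hQm : MeasurableSet (I ×ˢ S) := measurableSet_Ioo.prod hSm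
  have hwm : AEMeasurable (fun z : ℝ × EuclideanSpace ℝ (Fin 3) => v z.1 z.2 - U z.2)
      ((volume.restrict I).prod (volume.restrict S)) := by
    rw [Measure.prod_restrict, ← Measure.volume_eq_prod]
    exact ((hwc.mono hQsub).aestronglyMeasurable hQm).aemeasurable
  have hG1m : AEMeasurable G1 (volume.restrict I) := hwm.enorm.lintegral_prod_right'
  have hG2m : AEMeasurable G2 (volume.restrict I) := (hwm.enorm.pow_const 2).lintegral_prod_right'
  -- Tonelli: `∫_I G2 = ∫∫_{I×S} |w|² ≤ ε ρ Δs`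
  have hT2 : ∫⁻ t in I, G2 t ≤ ENNReal.ofReal (η ^ 2 * ρ * Δs) := by
    have h := setLIntegral_prod (μ := (volume : Measure ℝ)) (ν := (volume : Measure (EuclideanSpace ℝ (Fin 3))))
      (s := I) (t := S) (fun z : ℝ × EuclideanSpace ℝ (Fin 3) => ‖v z.1 z.2 - U z.2‖ₑ ^ 2)
      (by rw [← Measure.prod_restrict]; exact hwm.enorm.pow_const 2)
    rw [← Measure.volume_eq_prod] at h
    rw [← h]
    exact hclose
  -- Young on the shell: `∫_I G1 ≤ (2γ)⁻¹ ∫_I G2 + (γ/2) |S| |I|` with `γ = η/ρ`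
  set γ : ℝ := η / ρ with hγ_def
  have hγ : 0 < γ := by positivity
  have hV : volume (ball (0 : EuclideanSpace ℝ (Fin 3)) 1) = ENNReal.ofReal V₁ := by
    rw [hV₁_def, ENNReal.ofReal_toReal hV₁top]
  have hvolS : volume S ≤ ENNReal.ofReal (ρ ^ 3 * V₁) := by
    calc volume S ≤ volume (ball (0 : EuclideanSpace ℝ (Fin 3)) ρ) := measure_mono fun x hx => hx.1
      _ = ENNReal.ofReal (ρ ^ 3 * V₁) := by
          rw [landauTail_shellFloor_volume_ball hρ, hV, ← ENNReal.ofReal_mul (by positivity)]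
  have hvolI : volume I = ENNReal.ofReal Δs := by rw [hI_def, Real.volume_Ioo]
  have hT1 : ∫⁻ t in I, G1 t ≤ ENNReal.ofReal (1 / (2 * γ)) * ENNReal.ofReal (η ^ 2 * ρ * Δs) +
      ENNReal.ofReal (γ / 2) * ENNReal.ofReal (ρ ^ 3 * V₁) * ENNReal.ofReal Δs := by
    have hpt : ∀ t, G1 t ≤ ENNReal.ofReal (1 / (2 * γ)) * G2 t + ENNReal.ofReal (γ / 2) * volume S := by
      intro t
      calc G1 t ≤ ∫⁻ x in S, (ENNReal.ofReal (1 / (2 * γ)) * ‖v t x - U x‖ₑ ^ 2 + ENNReal.ofReal (γ / 2)) :=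
            lintegral_mono fun x => landauTail_shellFloor_enorm_le _ hγ
        _ = ENNReal.ofReal (1 / (2 * γ)) * G2 t + ENNReal.ofReal (γ / 2) * volume S := by
            rw [lintegral_add_right _ measurable_const, lintegral_const_mul' _ _ ENNReal.ofReal_ne_top,
              setLIntegral_const]
    calc ∫⁻ t in I, G1 t
        ≤ ∫⁻ t in I, (ENNReal.ofReal (1 / (2 * γ)) * G2 t + ENNReal.ofReal (γ / 2) * volume S) :=
          lintegral_mono fun t => hpt t
      _ = ENNReal.ofReal (1 / (2 * γ)) * (∫⁻ t in I, G2 t) + ENNReal.ofReal (γ / 2) * volume S * volume I := by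
          rw [lintegral_add_right' _ aemeasurable_const, lintegral_const_mul'' _ hG2m, setLIntegral_const]
      _ ≤ _ := by
          rw [hvolI]
          gcongr
  -- the integrated error in `ℝ≥0∞`
  have hB : ∫⁻ t in I, ENNReal.ofReal |Fl t + β| ≤ ENNReal.ofReal (β * Δs / 2) := by
    have hreal : A₁ * (1 / (2 * γ) * (η ^ 2 * ρ * Δs) + γ / 2 * (ρ ^ 3 * V₁) * Δs) + A₂ * (η ^ 2 * ρ * Δs)
        ≤ β * Δs / 2 := by
      have e1 : A₁ * (1 / (2 * γ) * (η ^ 2 * ρ * Δs)) = K * (1 + 4 * L) * η * Δs / 2 := by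
        rw [hA₁_def, hγ_def]; field_simp
      have e2 : A₁ * (γ / 2 * (ρ ^ 3 * V₁) * Δs) = K * (1 + 4 * L) * V₁ * η * Δs / 2 := by
        rw [hA₁_def, hγ_def]; field_simp
      have e3 : A₂ * (η ^ 2 * ρ * Δs) = K * η ^ 2 * Δs := by
        rw [hA₂_def]; field_simp
      have hη2 : K * η ^ 2 * Δs ≤ K * η * Δs := by
        have hη' : η ^ 2 ≤ η := pow_le_of_le_one hη0.le hη1 two_ne_zero
        have hKΔ : 0 ≤ K * Δs := by positivity
        calc K * η ^ 2 * Δs = K * Δs * η ^ 2 := by ring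
          _ ≤ K * Δs * η := mul_le_mul_of_nonneg_left hη' hKΔ
          _ = K * η * Δs := by ring
      have hmain : K * (1 + 4 * L) * η * Δs / 2 + K * (1 + 4 * L) * V₁ * η * Δs / 2 + K * η * Δs
          = κ * η * Δs := by rw [hκ_def]; ring
      have hfin : κ * η * Δs ≤ β * Δs / 2 := by
        have h1 : κ * η ≤ κ * (β / (2 * (κ + 1))) := mul_le_mul_of_nonneg_left hηβ hκ
        have h2 : κ * (β / (2 * (κ + 1))) ≤ β / 2 := by
          rw [mul_div_assoc', div_le_div_iff₀ (by positivity) two_pos]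
          have : 0 ≤ β * 2 := by positivity
          nlinarith [this]
        have h3 : κ * η * Δs ≤ β / 2 * Δs := mul_le_mul_of_nonneg_right (h1.trans h2) hΔs.le
        linarith [h3]
      rw [mul_add, e1, e2, e3]
      linarith [hmain, hη2, hfin]
    calc ∫⁻ t in I, ENNReal.ofReal |Fl t + β|
        ≤ ∫⁻ t in I, (ENNReal.ofReal A₁ * G1 t + ENNReal.ofReal A₂ * G2 t) := setLIntegral_mono' measurableSet_Ioo hP
      _ = ENNReal.ofReal A₁ * (∫⁻ t in I, G1 t) + ENNReal.ofReal A₂ * (∫⁻ t in I, G2 t) := by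
          rw [lintegral_add_left' (hG1m.const_mul _), lintegral_const_mul'' _ hG1m, lintegral_const_mul'' _ hG2m]
      _ ≤ ENNReal.ofReal A₁ * (ENNReal.ofReal (1 / (2 * γ)) * ENNReal.ofReal (η ^ 2 * ρ * Δs) +
            ENNReal.ofReal (γ / 2) * ENNReal.ofReal (ρ ^ 3 * V₁) * ENNReal.ofReal Δs) +
            ENNReal.ofReal A₂ * ENNReal.ofReal (η ^ 2 * ρ * Δs) := by
          gcongr
      _ = ENNReal.ofReal (A₁ * (1 / (2 * γ) * (η ^ 2 * ρ * Δs) + γ / 2 * (ρ ^ 3 * V₁) * Δs) +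
            A₂ * (η ^ 2 * ρ * Δs)) := by
          rw [← ENNReal.ofReal_mul (by positivity), ← ENNReal.ofReal_mul (by positivity),
            ← ENNReal.ofReal_mul (by positivity), ← ENNReal.ofReal_add (by positivity) (by positivity),
            ← ENNReal.ofReal_mul hA₁, ← ENNReal.ofReal_mul hA₂, ← ENNReal.ofReal_add (by positivity) (by positivity)]
      _ ≤ ENNReal.ofReal (β * Δs / 2) := ENNReal.ofReal_le_ofReal hreal
  -- back to the real integral of `|Fl + β|` over `(s₁, s₂)` and the momentum drop
  have hFlc : ContinuousOn (fun t => Fl t + β) (Icc s₁ s₂) := (hcont.mono hIcc).add continuousOn_const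
  have habs_int : ∫ t in I, |Fl t + β| ≤ β * Δs / 2 := by
    have hm : AEStronglyMeasurable (fun t => |Fl t + β|) (volume.restrict I) :=
      ((hFlc.mono Ioo_subset_Icc_self).abs).aestronglyMeasurable measurableSet_Ioo
    rw [integral_eq_lintegral_of_nonneg_ae (Eventually.of_forall fun t => abs_nonneg _) hm]
    exact ENNReal.toReal_le_of_le_ofReal (by positivity) hB
  have hdrop : β * Δs / 2 ≤ M s₁ - M s₂ := by
    have h := landauTail_shellFloor_drop (M := M) (F := Fl) hs₁₂ (fun t ht => hder t (hIcc ht)) (hcont.mono hIcc)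
      habs_int
    rw [hΔs_def] at h ⊢
    linarith
  -- an endpoint with large momentum
  obtain ⟨t₀, ht₀, hMt₀⟩ : ∃ t₀ ∈ Icc s₁ s₂, β * Δs / 4 ≤ |M t₀| := by
    by_cases h : β * Δs / 4 ≤ |M s₁|
    · exact ⟨s₁, left_mem_Icc.2 hs₁₂.le, h⟩
    · refine ⟨s₂, right_mem_Icc.2 hs₁₂.le, ?_⟩
      have h1 := le_abs_self (M s₁)
      rw [not_le] at h
      have : β * Δs / 4 ≤ -M s₂ := by linarith
      exact this.trans (neg_le_abs _)
  refine ⟨t₀, ht₀, ?_⟩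
  have ht₀' : t₀ ∈ Ioo (-1 : ℝ) 0 := hIcc ht₀
  have hvt : Continuous (v t₀) := (hcl.contDiff_velocity ht₀').continuous
  have hEint : IntegrableOn (fun x => ‖v t₀ x‖ ^ 2) (ball (0 : EuclideanSpace ℝ (Fin 3)) ρ) volume :=
    ((hvt.norm.pow 2).continuousOn.integrableOn_compact (isCompact_closedBall 0 ρ)).mono_set
      ball_subset_closedBall
  have hElow := landauTail_shellFloor_energy_of_momentum hvt hφK hφsupp hKpos hρ (by positivity) hMt₀
  have hcle : c * Δs ^ 2 / ρ ^ 3 ≤ ∫ x in ball (0 : EuclideanSpace ℝ (Fin 3)) ρ, ‖v t₀ x‖ ^ 2 := by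
    refine le_trans (le_of_eq ?_) hElow
    rw [hc_def, hV₁_def]
    field_simp
  calc ENNReal.ofReal (c * (s₂ - s₁) ^ 2 / ρ ^ 3)
      ≤ ENNReal.ofReal (∫ x in ball (0 : EuclideanSpace ℝ (Fin 3)) ρ, ‖v t₀ x‖ ^ 2) := ENNReal.ofReal_le_ofReal hcle
    _ = ∫⁻ x in ball (0 : EuclideanSpace ℝ (Fin 3)) ρ, ‖v t₀ x‖ₑ ^ 2 := by
        rw [ofReal_integral_eq_lintegral_ofReal hEint (Eventually.of_forall fun x => by positivity)]
        exact lintegral_congr fun x => by rw [← ofReal_norm, ENNReal.ofReal_pow (norm_nonneg _)]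

end Summit.NavierStokesRegularity.NavierStokesRegularity.Theorems

end
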